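import Mathlib
import Summits.KontsevichZagierPeriods.Zeta5Search.TypeSpaceLawZeroFinal
import Summits.KontsevichZagierPeriods.Zeta5Search.TypeSpacePoints
import Summits.KontsevichZagierPeriods.Zeta5Search.SecondOrderLive
import Summits.KontsevichZagierPeriods.Zeta5Search.CellKitLevel
import Summits.KontsevichZagierPeriods.Zeta5Search.CollinearityOrbits
import Summits.KontsevichZagierPeriods.Zeta5Search.ConstantTermFloorWindow
import HarnessLib

/-!
# ζ(5) search — the record zero windows reduce to a CLASS-STRUCTURE statement (census g21 type-point atlas)

Cell `pub-zeta5` (HONEST FRAMING: systematic search; no irrationality claim unless certified), census seat generation 21 (DRAFT for the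
typer / P1 / p3 seats; `p`-adic bookkeeping of a systematic search — nothing here bears on irrationality).

The census TYPE-POINT ATLAS (`code/census/g21/typepoints.py`, exact port of `ResidueLaw.pointW/pointV`, three implementations agreeing on
12 030 rational values; rate enumeration of every θ-sub-cell + 6 733 window instances `n ≤ 300`, 0 exceptions) shows that on each of the five ZERO
record windows (`RecWindowM26/M18/M14/M10/M8`) the doubled orbit points of the live classes take EXACTLY TWO values: every live class is
(i) deep with a palindromic type `T ∈ D`, (ii) a SATELLITE of some `T ∈ D` (a single raise of `T`, or the odd-centre class of list `T`), or
(iii) a member of ONE extra conjugate pair of type list `s ∈ S` (or its conjugate), with `|D| + |S| = 2`.  Hence hypothesis (h7) of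
`TypeSpaceLawZero` holds with `affDet = 0` EXACTLY and NO rational identity is needed: this file proves
* `point_mem_vals` — under `ZeroWindowClasses b p M D S` every live point lies in `D.map deepPoint ++ S.map pairPoint`
  (tree lemmas `pointW_deep`, `deep_data`, `live_pair`, `wHat_level`, `wHat_conj_level` by name);
* `affDet_eq_zero_of_classes` — with `D.length + S.length ≤ 2` all affine determinants vanish (pigeonhole);
* `recWindow_of_classes` — `TypeSpaceLawZero` (a THEOREM, `typeSpaceLawZero_holds`) + the class structure ⇒ the window bound `6 − 2M`;
* the five record statements `RecZeroClassesM..` (decidable per instance; the predicate `ZeroWindowClasses (bRec n) p M D.. S..` evaluated LITERALLY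
  at every window prime with `n ≤ 300` — 4 297 instances, 4 305 827 pole classes, 0 failures: `code/census/g21/zwc_check.py`, `xsave/g21/v21/zwc_check_n300.json`)
  and the PROVED reductions `recWindowM.._of : RecZeroClassesM.. → RecWindowM..` (so `RecWindowM26/M18/M14/M10/M8` are now conditional ONLY on a
  class-structure statement about the integer data `netExp (bRec n)`, exactly like `RecordWindowsA4.recWindowM56_of` but with `TypeSpaceLawZero` a theorem).
The ORIGIN windows `RecWindowM12/M28` (law `TypeSpaceLawOrigin`, not yet proved) need genuine rational identities (3–4 distinct collinear points) and are
not treated here; the odd-`M` layers `RecWindowM8Layer/M14Layer` are outside `TypeSpaceLawZero` (`Even M`).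
-/

noncomputable section

open Finset

namespace Summit.KontsevichZagierPeriods.Zeta5Search.ZeroWindows

open Summit.KontsevichZagierPeriods.Zeta5Search.CasoratianValuation (InPolytope shift casoratian)
open Summit.KontsevichZagierPeriods.Zeta5Search.ClusterValuation
open Summit.KontsevichZagierPeriods.Zeta5Search.SecondOrder
open Summit.KontsevichZagierPeriods.Zeta5Search.ResidueLaw
open Summit.KontsevichZagierPeriods.Zeta5Search.LevelClass (typeW typeV wHat_level vHat_level typeW_congr typeV_congr)
open Summit.KontsevichZagierPeriods.Zeta5Search.CellKit (wHat_conj_level vHat_conj_level conj_level)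
open Summit.KontsevichZagierPeriods.Zeta5Search.WedgeDictionary (dOf)

variable {p : ℕ} [hp : Fact p.Prime]

/-! ## §1 The two kinds of point values -/

/-- The doubled orbit point carried by a deep palindromic type `T` and by all its satellites: `2τ(T)`. -/
def deepPoint (T : List ℤ) : ℚ × ℚ := (2 * typeTauW (tTop T) (tList T), 2 * typeTauV (tTop T) (tList T))

/-- The doubled orbit point of an extra conjugate pair with type list `s` (conjugate list = `s` reversed): `2(σ(s) + σ(s^rev))`. -/
def pairPoint (s : List ℤ) : ℚ × ℚ :=
  (2 * (typeW (tTop s) (tList s) + typeW (tTop s) (fun k => tList s (tTop s - k))),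
   2 * (typeV (tTop s) (tList s) + typeV (tTop s) (fun k => tList s (tTop s - k))))

/-- **ZERO-WINDOW CLASS STRUCTURE** with deep palindromes `D` and extra pairs `S`: (G1) every pole class has `E ≥ −M`; every pole class of
exponent `−M` is centre-free with type list in `D`; every pole class of exponent `−M+1` is a satellite of some `T ∈ D` (single raise, or the
odd-centre class of list `T`) or a centre-free class whose type list, or whose conjugate's type list, lies in `S`. -/
def ZeroWindowClasses (b : ℕ → ℤ) (p M : ℕ) (D S : List (List ℤ)) : Prop :=
  (∀ x, x < p → 1 ≤ classPoleCount b p x → -(M : ℤ) ≤ classExp b p x) ∧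
  (∀ x, x < p → 1 ≤ classPoleCount b p x → classExp b p x = -(M : ℤ) → ¬ CentreIn b p x ∧ classTypeList b p x ∈ D) ∧
  (∀ y, y < p → 1 ≤ classPoleCount b p y → classExp b p y = -(M : ℤ) + 1 →
      (∃ T ∈ D, isRaise T (classTypeList b p y) = true ∨ (¬ (2 : ℤ) ∣ b 0 ∧ CentreIn b p y ∧ classTypeList b p y = T)) ∨
      (¬ CentreIn b p y ∧ ∃ s ∈ S, classTypeList b p y = s ∨ classTypeList b p (conjClass b p y) = s))

/-! ## §2 Pigeonhole: three points among two values -/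

omit hp in
/-- Three live points drawn from a list of at most two values have vanishing affine determinant. -/
theorem affDet_eq_zero_of_mem (b : ℕ → ℤ) (p M : ℕ) (vals : List (ℚ × ℚ)) (hlen : vals.length ≤ 2) {x y z : ℕ}
    (hx : (pointW b p M x, pointV b p M x) ∈ vals) (hy : (pointW b p M y, pointV b p M y) ∈ vals)
    (hz : (pointW b p M z, pointV b p M z) ∈ vals) : affDet b p M x y z = 0 := by
  unfold affDet
  match vals, hlen, hx, hy, hz with
  | [], _, hx, _, _ => simp at hx
  | [(a1, a2)], _, hx, hy, hz =>
      simp only [List.mem_singleton, Prod.mk.injEq] at hx hy hz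
      rw [hx.1, hx.2, hy.1, hy.2, hz.1, hz.2]; ring
  | [(a1, a2), (c1, c2)], _, hx, hy, hz =>
      simp only [List.mem_cons, Prod.mk.injEq, List.not_mem_nil, or_false] at hx hy hz
      rcases hx with hx | hx <;> rcases hy with hy | hy <;> rcases hz with hz | hz <;>
        rw [hx.1, hx.2, hy.1, hy.2, hz.1, hz.2] <;> ring
  | _ :: _ :: _ :: _, h, _, _, _ => simp at h

/-! ## §3 Every live point is a deep point or a pair point -/

section Points

variable (b : ℕ → ℤ) (hb : InPolytope b) (hpn : (p : ℤ) ≤ b 0) {M : ℕ} (hM : 6 ≤ M) (hMe : Even M) {D S : List (List ℤ)}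
  (hD : ∀ T ∈ D, T.reverse = T) (hC : ZeroWindowClasses b p M D S)
include hb hpn hM hMe hD hC

/-- **Every live point lies in `D.map deepPoint ++ S.map pairPoint`.** -/
theorem point_mem_vals {y : ℕ} (hy : y ∈ liveClasses b p M) :
    (pointW b p M y, pointV b p M y) ∈ D.map deepPoint ++ S.map pairPoint := by
  have h0 : 0 ≤ b 0 := hb.1.1
  have hpnN : p ≤ (b 0).toNat := by omega
  obtain ⟨hyr, hpole, hE⟩ := mem_filter.1 hy
  have hyp : y < p := mem_range.1 hyr
  have hyn : y ≤ (b 0).toNat := le_b0_of_lt b hpn hyp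
  obtain ⟨G1, G3, G4⟩ := hC
  rcases hE with hE | hE
  · -- (i) deep class
    obtain ⟨hc, hTD⟩ := G3 y hyp hpole hE
    set T := classTypeList b p y with hTdef
    have hT : T.reverse = T := hD T hTD
    have hodd : Odd (3 + classExp b p y) := by
      obtain ⟨r, hr⟩ := hMe; rw [hE, hr]; exact ⟨1 - r, by push_cast; ring⟩
    obtain ⟨-, hτW, hτV, -⟩ := deep_data b hb hpn hT hyp hc hTdef.symm hodd
    have hW := pointW_deep b hb hpn hyp hc (by rw [← hTdef]; exact hT) hE
    have hV := pointV_deep b hb hpn hyp hc (by rw [← hTdef]; exact hT) hE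
    refine List.mem_append.2 (Or.inl (List.mem_map.2 ⟨T, hTD, ?_⟩))
    simp only [deepPoint, hW, hV, hτW, hτV]
  · -- sub-deep class
    have hne : classExp b p y ≠ -(M : ℤ) := by omega
    have hneg : classExp b p y < 0 := by omega
    rcases G4 y hyp hpole hE with ⟨T, hTD, h4⟩ | ⟨hc, s, hsS, hs⟩
    · -- (ii) satellite of `T`
      have hT : T.reverse = T := hD T hTD
      obtain ⟨hw, hv⟩ := live_pair b hb hpn hT hyp hpole hneg h4
      refine List.mem_append.2 (Or.inl (List.mem_map.2 ⟨T, hTD, ?_⟩))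
      by_cases hcen : CentreIn b p y
      · have hself : conjClass b p y = y := (centreIn_iff_conjClass_eq b hpnN hyp).1 hcen
        rw [hself] at hw hv
        simp only [deepPoint, pointW, pointV, if_neg hne, if_pos hcen, Prod.mk.injEq]
        constructor <;> linarith
      · simp only [deepPoint, pointW, pointV, if_neg hne, if_neg hcen, SecondOrder.orbitW, SecondOrder.orbitV, Prod.mk.injEq]
        exact ⟨by rw [← hw]; rfl, by rw [← hv]; rfl⟩
    · -- (iii) extra conjugate pair
      refine List.mem_append.2 (Or.inr (List.mem_map.2 ⟨s, hsS, ?_⟩))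
      -- the pair sum at a centre-free class `z < p` with type list `s`
      have key : ∀ z, z < p → ¬ CentreIn b p z → classTypeList b p z = s →
          wHat b p z + wHat b p (conjClass b p z) = typeW (tTop s) (tList s) + typeW (tTop s) (fun k => tList s (tTop s - k)) ∧
          vHat b p z + vHat b p (conjClass b p z) = typeV (tTop s) (tList s) + typeV (tTop s) (fun k => tList s (tTop s - k)) := by
        intro z hz hcz hts
        have hzn : z ≤ (b 0).toNat := le_b0_of_lt b hpn hz
        obtain ⟨hL, hL'⟩ := level_bounds' (p := p) b hzn
        obtain ⟨htop, he⟩ := spec_of_typeList b hzn hts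
        rw [htop]
        have h1 : wHat b p z = typeW (topLevel b p z) (tList s) := wHat_level b hz hL hL' (tList s) he hcz
        have h2 : wHat b p (conjClass b p z) = typeW (topLevel b p z) (fun k => tList s (topLevel b p z - k)) :=
          wHat_conj_level b hz hL hL' hb (tList s) he hcz
        have h3 : vHat b p z = typeV (topLevel b p z) (tList s) := vHat_level b hz hL hL' (tList s) he hcz
        have h4 : vHat b p (conjClass b p z) = typeV (topLevel b p z) (fun k => tList s (topLevel b p z - k)) :=
          vHat_conj_level b hz hL hL' hb (tList s) he hcz
        exact ⟨by rw [h1, h2], by rw [h3, h4]⟩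
      have hsum : wHat b p y + wHat b p (conjClass b p y) = typeW (tTop s) (tList s) + typeW (tTop s) (fun k => tList s (tTop s - k)) ∧
          vHat b p y + vHat b p (conjClass b p y) = typeV (tTop s) (tList s) + typeV (tTop s) (fun k => tList s (tTop s - k)) := by
        rcases hs with hs | hs
        · exact key y hyp hc hs
        · obtain ⟨hL, hL'⟩ := level_bounds' (p := p) b hyn
          obtain ⟨hy', -, -⟩ := conj_level b hyp hL hL'
          have hc' : ¬ CentreIn b p (conjClass b p y) := fun h => hc ((centreIn_conj_iff b h0 hyn).1 h)
          have k2 := key (conjClass b p y) hy' hc' hs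
          rw [conjClass_conjClass b hyp hpnN] at k2
          exact ⟨by rw [add_comm]; exact k2.1, by rw [add_comm]; exact k2.2⟩
      simp only [pairPoint, pointW, pointV, if_neg hne, if_neg hc, SecondOrder.orbitW, SecondOrder.orbitV, Prod.mk.injEq]
      exact ⟨by rw [← hsum.1]; rfl, by rw [← hsum.2]; rfl⟩

/-- **(h7) for free**: with at most two point values all affine determinants of live triples vanish. -/
theorem affDet_eq_zero_of_classes (hlen : D.length + S.length ≤ 2) :
    ∀ x ∈ liveClasses b p M, ∀ y ∈ liveClasses b p M, ∀ z ∈ liveClasses b p M, affDet b p M x y z = 0 :=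
  fun _ hx _ hy _ hz => affDet_eq_zero_of_mem b p M (D.map deepPoint ++ S.map pairPoint) (by simpa using hlen)
    (point_mem_vals b hb hpn hM hMe hD hC hx) (point_mem_vals b hb hpn hM hMe hD hC hy) (point_mem_vals b hb hpn hM hMe hD hC hz)

end Points

/-! ## §4 The window bound from the class structure -/

/-- **`TypeSpaceLawZero` through `ZeroWindowClasses`**: on the polytope with `5 ≤ p ≤ b₀ < p² − 2`, `M ≥ 6` even, DEG, deep palindromes `D` and
extra pairs `S` with `|D| + |S| ≤ 2`:  `v_p(Cas_j(b)) ≥ 6 − 2M`. -/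
theorem bound_of_classes (b : ℕ → ℤ) (j M : ℕ) (D S : List (List ℤ)) (hb : InPolytope b) (hbj : InPolytope (shift b j))
    (hj1 : 1 ≤ j) (hj7 : j ≤ 7) (h5 : 5 ≤ p) (hpn : (p : ℤ) ≤ b 0) (hp2 : (b 0 + 2 : ℤ) < (p : ℤ) ^ 2) (hM : 6 ≤ M) (hMe : Even M)
    (hdeg : (p : ℤ) * ((M : ℤ) - 2) + ∑ x ∈ range p, classExp b p x ≤ -4)
    (hD : ∀ T ∈ D, T.reverse = T) (hlen : D.length + S.length ≤ 2) (hC : ZeroWindowClasses b p M D S)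
    (hne : casoratian b j ≠ 0) : (6 : ℤ) - 2 * M ≤ padicValRat p (casoratian b j) := by
  have G1 := hC.1
  have G3 : ∀ x, x < p → 1 ≤ classPoleCount b p x → classExp b p x = -(M : ℤ) →
      ¬ CentreIn b p x ∧ (classTypeList b p x).reverse = classTypeList b p x :=
    fun x hx h1 hE => ⟨(hC.2.1 x hx h1 hE).1, hD _ (hC.2.1 x hx h1 hE).2⟩
  exact typeSpaceLawZero_holds b p j M hb hbj hj1 hj7 hp.out h5 hpn hp2 hM hMe G1 G3 hdeg
    (fun x hx y hy z hz => Or.inl (affDet_eq_zero_of_classes b hb hpn hM hMe hD hC hlen x hx y hy z hz)) hne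

/-! ## §5 The five record zero windows (`b(n) = bRec n`, `Cas₇`) -/

/-- `M = 10`, `θ ∈ (6, 25/4)`: deep type and extra pair. -/
def D10 : List (List ℤ) := [[1, 0, -6, -6, 0, 1]]
/-- `M = 10`: the extra conjugate pair (list `s`). -/
def S10 : List (List ℤ) := [[1, -1, -6, -5, 1, 1]]
/-- `M = 8`, `θ ∈ [41/5 + 3/(5n), 25/3)`. -/
def D8 : List (List ℤ) := [[1, -5, -5, 1]]
/-- `M = 8`: the extra conjugate pair. -/
def S8 : List (List ℤ) := [[1, -4, -6, 1, 1]]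
/-- `M = 14`, `θ ∈ [41/10 + 3/(10n), 25/6)`. -/
def D14 : List (List ℤ) := [[1, 1, -1, -5, -6, -5, -1, 1, 1]]
/-- `M = 14`: the extra conjugate pair. -/
def S14 : List (List ℤ) := [[1, 1, 0, -4, -6, -6, -2, 1, 1, 1]]
/-- `M = 18`, `θ ∈ (3, 25/8)`. -/
def D18 : List (List ℤ) := [[1, 1, 1, 0, -3, -6, -6, -6, -3, 0, 1, 1, 1]]
/-- `M = 18`: the extra conjugate pair. -/
def S18 : List (List ℤ) := [[1, 1, 1, -1, -4, -6, -6, -5, -2, 1, 1, 1, 1]]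
/-- `M = 26`, `θ ∈ (2, 25/12)`: TWO deep palindromes, no extra pair. -/
def D26 : List (List ℤ) :=
  [[1, 1, 1, 1, 1, -1, -3, -5, -6, -6, -6, -5, -3, -1, 1, 1, 1, 1, 1], [1, 1, 1, 1, 1, 0, -2, -4, -6, -6, -6, -6, -4, -2, 0, 1, 1, 1, 1, 1]]
/-- `M = 26`: no extra pair. -/
def S26 : List (List ℤ) := []

/-- **CLASS STRUCTURE, zero window `M = 10`** (`6n < p`, `4p < 25n`).  Census g21: every window prime with `n ≤ 300` (1 579 instances) and
every θ-sub-cell at rate. -/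
@[conjecture] def RecZeroClassesM10 : Prop :=
  ∀ n p : ℕ, 2 ≤ n → p.Prime → 6 * n < p → 4 * p < 25 * n → ZeroWindowClasses (bRec n) p 10 D10 S10
/-- **CLASS STRUCTURE, zero window `M = 8`** (`41n + 3 ≤ 5p`, `3p < 25n`; 798 instances `n ≤ 300`). -/
@[conjecture] def RecZeroClassesM8 : Prop :=
  ∀ n p : ℕ, 2 ≤ n → p.Prime → 41 * n + 3 ≤ 5 * p → 3 * p < 25 * n → ZeroWindowClasses (bRec n) p 8 D8 S8
/-- **CLASS STRUCTURE, zero window `M = 14`** (`41n + 3 ≤ 10p`, `6p < 25n`; 437 instances `n ≤ 300`). -/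
@[conjecture] def RecZeroClassesM14 : Prop :=
  ∀ n p : ℕ, 2 ≤ n → p.Prime → 41 * n + 3 ≤ 10 * p → 6 * p < 25 * n → ZeroWindowClasses (bRec n) p 14 D14 S14
/-- **CLASS STRUCTURE, zero window `M = 18`** (`3n < p`, `8p < 25n`; 864 instances `n ≤ 300`). -/
@[conjecture] def RecZeroClassesM18 : Prop :=
  ∀ n p : ℕ, 2 ≤ n → p.Prime → 3 * n < p → 8 * p < 25 * n → ZeroWindowClasses (bRec n) p 18 D18 S18
/-- **CLASS STRUCTURE, zero window `M = 26`** (`2n < p`, `12p < 25n`; 619 instances `n ≤ 300`). -/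
@[conjecture] def RecZeroClassesM26 : Prop :=
  ∀ n p : ℕ, 2 ≤ n → p.Prime → 2 * n < p → 12 * p < 25 * n → ZeroWindowClasses (bRec n) p 26 D26 S26

/-- `(bRec n) 0 = 41 n`. -/
private theorem bRec_zero' (n : ℕ) : bRec n 0 = 41 * (n : ℤ) := by
  simp [bRec, mul_comm]

/-- `dOf (bRec n) = 25 n` on the record ray. -/
private theorem dOf_bRec (n : ℕ) : dOf (bRec n) = 25 * (n : ℤ) := by
  simp [dOf, bRec, Finset.sum_range_succ]; ring

/-- DEG on the record ray: `Σ_{x<p} E_x = −50n − 5`, so DEG ⟺ `p(M − 2) ≤ 50n + 1`. -/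
theorem deg_bRec (n M : ℕ) (h5 : 5 ≤ p) (h : (p : ℤ) * ((M : ℤ) - 2) ≤ 50 * n + 1) :
    (p : ℤ) * ((M : ℤ) - 2) + ∑ x ∈ range p, classExp (bRec n) p x ≤ -4 := by
  rw [sum_classExp_range (bRec n) (inPolytope_bRec n) h5, dOf_bRec]; omega

/-- The generic window reduction on the record ray. -/
theorem recWindow_of_classes (n p' M : ℕ) (D S : List (List ℤ)) (hn : 2 ≤ n) (hp' : p'.Prime) (h5 : 5 ≤ p')
    (hpn : p' ≤ 41 * n) (hp2 : 41 * n + 2 < p' ^ 2) (hM : 6 ≤ M) (hMe : Even M) (hdeg : (p' : ℤ) * ((M : ℤ) - 2) ≤ 50 * n + 1)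
    (hD : ∀ T ∈ D, T.reverse = T) (hlen : D.length + S.length ≤ 2) (hC : ZeroWindowClasses (bRec n) p' M D S)
    (hne : casoratian (bRec n) 7 ≠ 0) : (6 : ℤ) - 2 * M ≤ padicValRat p' (casoratian (bRec n) 7) := by
  haveI : Fact p'.Prime := ⟨hp'⟩
  have hpb : (p' : ℤ) ≤ bRec n 0 := by rw [bRec_zero']; exact_mod_cast hpn
  have hp2' : (bRec n 0 + 2 : ℤ) < (p' : ℤ) ^ 2 := by rw [bRec_zero']; exact_mod_cast hp2
  exact bound_of_classes (bRec n) 7 M D S (inPolytope_bRec n) (inPolytope_shift_bRec n 7 (by omega) (by norm_num) (by norm_num))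
    (by norm_num) (by norm_num) h5 hpb hp2' hM hMe (deg_bRec n M h5 hdeg) hD hlen hC hne

/-- **`RecWindowM10` from its class structure.** -/
theorem recWindowM10_of (hC : RecZeroClassesM10) : RecWindowM10 := by
  intro n p hn hp h1 h2 hne
  have h5 : 5 ≤ p := by omega
  have hp2 : 41 * n + 2 < p ^ 2 := by nlinarith
  exact recWindow_of_classes n p 10 D10 S10 hn hp h5 (by omega) hp2 (by norm_num) (by decide) (by push_cast; nlinarith)
    (by decide) (by decide) (hC n p hn hp h1 h2) hne

/-- **`RecWindowM8` from its class structure.** -/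
theorem recWindowM8_of (hC : RecZeroClassesM8) : RecWindowM8 := by
  intro n p hn hp h1 h2 hne
  have h5 : 5 ≤ p := by omega
  have hp2 : 41 * n + 2 < p ^ 2 := by nlinarith
  exact recWindow_of_classes n p 8 D8 S8 hn hp h5 (by omega) hp2 (by norm_num) (by decide) (by push_cast; nlinarith)
    (by decide) (by decide) (hC n p hn hp h1 h2) hne

/-- **`RecWindowM14` from its class structure.** -/
theorem recWindowM14_of (hC : RecZeroClassesM14) : RecWindowM14 := by
  intro n p hn hp h1 h2 hne
  have h5 : 5 ≤ p := by omega
  have hp2 : 41 * n + 2 < p ^ 2 := by nlinarith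
  exact recWindow_of_classes n p 14 D14 S14 hn hp h5 (by omega) hp2 (by norm_num) (by decide) (by push_cast; nlinarith)
    (by decide) (by decide) (hC n p hn hp h1 h2) hne

/-- **`RecWindowM18` from its class structure.** -/
theorem recWindowM18_of (hC : RecZeroClassesM18) : RecWindowM18 := by
  intro n p hn hp h1 h2 hne
  have hn9 : 9 ≤ n := by omega
  have h5 : 5 ≤ p := by omega
  have hp2 : 41 * n + 2 < p ^ 2 := by nlinarith
  exact recWindow_of_classes n p 18 D18 S18 hn hp h5 (by omega) hp2 (by norm_num) (by decide) (by push_cast; nlinarith)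
    (by decide) (by decide) (hC n p hn hp h1 h2) hne

/-- **`RecWindowM26` from its class structure.** -/
theorem recWindowM26_of (hC : RecZeroClassesM26) : RecWindowM26 := by
  intro n p hn hp h1 h2 hne
  have hn12 : 12 ≤ n := by omega
  have h5 : 5 ≤ p := by omega
  have hp2 : 41 * n + 2 < p ^ 2 := by nlinarith
  exact recWindow_of_classes n p 26 D26 S26 hn hp h5 (by omega) hp2 (by norm_num) (by decide) (by push_cast; nlinarith)
    (by decide) (by decide) (hC n p hn hp h1 h2) hne

end Summit.KontsevichZagierPeriods.Zeta5Search.ZeroWindows
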